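import Summits.CriticalPhenomena.PercolationContinuityZ3.Theorems.PercNearOneGluingNoHeavyLowerTailSahiCTCLadderSupplyGeneral
import HarnessLib

/-!
# `NoHeavyLowerTail` (crux stmt-CriticalPhenomena-4575), P3 lane: pinned supply incidence of a cube (general row)

Support file (seat `prim-l12-p3`, gen 26; `--supports stmt-CriticalPhenomena-4575`).  README blueprint step 2, general form, second part:
for a point `p ∈ A` of the cube `(A, Y)`, the charged pairs `(A', Y')` with `p ∈ A'` (resp. `p ∉ A'`) give distinct common `ℓ`-sets
containing (resp. avoiding) `p`: `sum_card_kindsIn_filter_mem_le`, `sum_card_kindsIn_filter_not_mem_le` — the incidence half of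
`pinnedT_le_kap` at `p`.  Nothing is asserted about the crux.
-/

namespace Summit.CriticalPhenomena.PercolationContinuityZ3.Theorems.SahiCTCForms

open Finset MvPolynomial SahiCTCGenFun SahiCTCWeightedLYM

variable {α : Type*} [DecidableEq α] [Fintype α]

section SupplyGeneralPinned
variable {𝒳 𝒵 : Finset (Finset α)}

omit [Fintype α] in
/-- Filtered incidence: if `R q ↔ R' (A' ∩ A ∪ Y')` on charged pairs, then `Σ_j #(kindsIn_j(A,Y) with R) ≤ #(csetsT(cube) with R')`.
[this work] -/
theorem sum_card_kindsIn_filter_le_csetsT {m : α →₀ ℕ} {t : ℕ} {A Y : Finset α} (hA : A ⊆ dbl m) (hδt : #(dbl m) ≤ t)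
    (R : Finset α × Finset α → Prop) [DecidablePred R] (R' : Finset α → Prop) [DecidablePred R']
    (hRR' : ∀ j, ∀ q ∈ kindsIn 𝒳 𝒵 m t j A Y, R q ↔ R' (q.1 ∩ A ∪ q.2)) :
    ∑ j ∈ range (#(dbl m) + 1), #((kindsIn 𝒳 𝒵 m t j A Y).filter R)
      ≤ #((csetsT 𝒳 𝒵 (dbl m \ A) (A ∪ (lev m 1 \ Y)) (t - #(dbl m \ A))).filter R') := by
  set S := (csetsT 𝒳 𝒵 (dbl m \ A) (A ∪ (lev m 1 \ Y)) (t - #(dbl m \ A))).filter R'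
  have hDT := disjoint_dbl_lev_one m
  have hAD : #A ≤ #(dbl m) := card_le_card hA
  have hfib : ∑ j ∈ range (#(dbl m) + 1), #(S.filter fun U => #(U ∩ A) + #(dbl m) - #A = j) = #S := by
    rw [← card_eq_sum_card_fiberwise]
    intro U _
    show #(U ∩ A) + #(dbl m) - #A ∈ range (#(dbl m) + 1)
    have : #(U ∩ A) ≤ #A := card_le_card inter_subset_right
    exact mem_range.2 (by omega)
  rw [← hfib]
  refine sum_le_sum fun j hj => ?_
  by_cases hjA : #(dbl m \ A) ≤ j
  · have hjt : j ≤ t := by have := mem_range.1 hj; omega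
    calc #((kindsIn 𝒳 𝒵 m t j A Y).filter R)
        = #((kindsIn 𝒳 𝒵 m t j A Y).filter fun q =>
            R' (q.1 ∩ A ∪ q.2) ∧ #((q.1 ∩ A ∪ q.2) ∩ A) + #(dbl m) - #A = j) := by
          refine congrArg card (filter_congr fun q hq => ?_)
          obtain ⟨-, ⟨hY', -⟩, -, -, -⟩ := mem_kindsIn.1 hq
          have h1 := (card_inter_fst_of_mem_kindsIn hA hq).1
          have h2 : (q.1 ∩ A ∪ q.2) ∩ A = A ∩ q.1 := by
            rw [union_inter_distrib_right, disjoint_iff_inter_eq_empty.1 (Disjoint.mono hY' hA hDT.symm), union_empty,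
              inter_assoc, inter_self, inter_comm]
          rw [hRR' j q hq, h2]
          constructor
          · intro h; exact ⟨h, by omega⟩
          · intro h; exact h.1
      _ ≤ #((csetsT 𝒳 𝒵 (dbl m \ A) (A ∪ (lev m 1 \ Y)) (t - #(dbl m \ A))).filter fun U =>
            R' U ∧ #(U ∩ A) + #(dbl m) - #A = j) :=
          card_kindsIn_filter_le_csetsT hA hjt hjA (fun U => R' U ∧ #(U ∩ A) + #(dbl m) - #A = j)
      _ = #(S.filter fun U => #(U ∩ A) + #(dbl m) - #A = j) := by rw [filter_filter]
  · have : kindsIn 𝒳 𝒵 m t j A Y = ∅ := by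
      refine filter_false_of_mem fun q hq => ?_
      obtain ⟨hA', _⟩ := mem_product.1 hq
      obtain ⟨_, hjc⟩ := mem_powersetCard.1 hA'
      intro h
      exact hjA (hjc ▸ card_le_card h.2.1)
    rw [this, filter_empty, card_empty]; exact Nat.zero_le _

omit [Fintype α] in
/-- **Pinned incidence, `p ∈ ·`**: for `p ∈ A`, `Σ_j #{(A',Y') ∈ kindsIn_j(A,Y) : p ∈ A'} ≤ #{U ∈ csetsT(cube) : p ∈ U}`. [this work] -/
theorem sum_card_kindsIn_filter_mem_le {m : α →₀ ℕ} {t : ℕ} {A Y : Finset α} (hA : A ⊆ dbl m) (hδt : #(dbl m) ≤ t)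
    {p : α} (hp : p ∈ A) :
    ∑ j ∈ range (#(dbl m) + 1), #((kindsIn 𝒳 𝒵 m t j A Y).filter fun q => p ∈ q.1)
      ≤ #((csetsT 𝒳 𝒵 (dbl m \ A) (A ∪ (lev m 1 \ Y)) (t - #(dbl m \ A))).filter fun U => p ∈ U) := by
  refine sum_card_kindsIn_filter_le_csetsT hA hδt (fun q => p ∈ q.1) (fun U => p ∈ U) fun j q hq => ?_
  obtain ⟨-, ⟨hY', -⟩, -, -, -⟩ := mem_kindsIn.1 hq
  have hpT : p ∉ q.2 := fun h => disjoint_left.1 (disjoint_dbl_lev_one m) (hA hp) (hY' h)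
  simp only [mem_union, mem_inter]
  tauto

omit [Fintype α] in
/-- **Pinned incidence, `p ∉ ·`**: for `p ∈ A`, `Σ_j #{(A',Y') ∈ kindsIn_j(A,Y) : p ∉ A'} ≤ #{U ∈ csetsT(cube) : p ∉ U}`. [this work] -/
theorem sum_card_kindsIn_filter_not_mem_le {m : α →₀ ℕ} {t : ℕ} {A Y : Finset α} (hA : A ⊆ dbl m) (hδt : #(dbl m) ≤ t)
    {p : α} (hp : p ∈ A) :
    ∑ j ∈ range (#(dbl m) + 1), #((kindsIn 𝒳 𝒵 m t j A Y).filter fun q => p ∉ q.1)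
      ≤ #((csetsT 𝒳 𝒵 (dbl m \ A) (A ∪ (lev m 1 \ Y)) (t - #(dbl m \ A))).filter fun U => p ∉ U) := by
  refine sum_card_kindsIn_filter_le_csetsT hA hδt (fun q => p ∉ q.1) (fun U => p ∉ U) fun j q hq => ?_
  obtain ⟨-, ⟨hY', -⟩, -, -, -⟩ := mem_kindsIn.1 hq
  have hpT : p ∉ q.2 := fun h => disjoint_left.1 (disjoint_dbl_lev_one m) (hA hp) (hY' h)
  simp only [mem_union, mem_inter]
  tauto

end SupplyGeneralPinned

end Summit.CriticalPhenomena.PercolationContinuityZ3.Theorems.SahiCTCForms
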